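import Literature.NumberTheory.EllipticCurves.ZpExtensionEisensteinDVRSetting
import Literature.NumberTheory.EllipticCurves.ZpExtensionEisensteinSelmerUnramifiedProofs
import Literature.NumberTheory.EllipticCurves.ZpExtensionScalarTwistFiniteProofs
import Literature.NumberTheory.EllipticCurves.IwasawaAlgebraEisensteinQuotientReadoutProofs
import Literature.NumberTheory.EllipticCurves.IwasawaAlgebraEisensteinQuotientReciprocity
import Literature.NumberTheory.EllipticCurves.ZpExtensionEisensteinTwistDualityForm
import Literature.NumberTheory.GaloisCohomology.Howard2004.UnramifiedSelfOrthogonalReadout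
import Literature.NumberTheory.GaloisCohomology.Howard2004.DualityDatumTateDualBijective
import Literature.NumberTheory.GaloisCohomology.Howard2004.TransportUnramified
import Literature.NumberTheory.GaloisRepresentations.CompatibleRootsOfUnityLogProofs
import HarnessLib

/-!
# `SatisfiesH.h4` for the curve's Eisenstein setting AT THE GOOD PLACES: `F_𝔮 = H¹_ur` is its own exact orthogonal
# complement under Howard's induced local pairing at every finite `v ∉ S` (proofs file)

Topic `NumberTheory/EllipticCurves` (cell `pub/bsd-print-x9`; companion of `ZpExtensionEisensteinDVRSetting` (D1); the assembly
of x9-p1-w4's H4-AT-N-PLAN §A).  THEOREMS ONLY; no definition, no named fact, no instance, no notation, no `sorry`.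

Howard, §1.3 H.4 [arXiv:1202.6340 p. 7, L78–82]: «the local condition `F` is its own exact orthogonal complement under the
induced local pairing `H¹(K_v, T) × H¹(K_v̄, T) → R` for every finite place `v`».  For the curve's Eisenstein tower
`T^{(k)} = E_K[p^{k+1}] ⊗ A_{m,k+1}(ψ)` (`WeierstrassCurve.eisensteinTower`) with local conditions `F_𝔮`
(`eisensteinTowerTriple … .cond = eisensteinSelmerStructure`) and ANY H.4 data `D k : DualityDatum p cd T^{(k)} A_{m,k+1}`:

* **`WeierstrassCurve.eisensteinTower_isSelfOrthogonalAt_of_not_mem`** — at a finite place `v` with `v, σ•v ∉ S` (`S ⊇ {v ∣ p} ∪`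
  bad places, so `T^{(k)}` is UNRAMIFIED at `v` and `F_𝔮 = H¹_ur` at `v` and `σ•v`), and a conjugation datum whose local
  transport `φ_v` respects inertia, `(D k).IsSelfOrthogonalAt F_𝔮 v` holds — GIVEN the tree's Poitou–Tate named fact
  `poitouTate_selmerStructure_duality K` (one family of local invariants, perfect and with `H¹_ur` self-orthogonal; binder
  `hPT` of the μ-LEAD ruling 15:12:02Z).  Assembly (H4-AT-N-PLAN §A): `DualityDatum.isSelfOrthogonalAt_of_unramified_of_bijective`
  with `p^{k+1} · T^{(k)} = 0` (`EisensteinCoeff.charP`), `T^{(k)}` unramified (`isUnramifiedAt_eisensteinTwist_torsionGaloisModule_of_not_mem`),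
  bridge `λ = tailFormZMod` (`tailFormZMod_ofZMod_mul`, `algebraMap_padicInt_eq_ofZMod_toZModPow`) and `exp = log⁻¹` for a
  `χ̄`-equivariant discrete logarithm (`exists_compatible_muLog`), `Θ` bijective (`toTateDual_bijective` +
  `tailFormZModComp_bijective`), the dualizing family `dualFamily` (`bijective_comp_tailFormZMod_dualFamily_mul`), the
  unfolding `eisensteinSelmerStructure_inr_of_not_mem`, and `ConjugationDatum.map_transportH1_unramifiedSubgroup_eq`.
* **`WeierstrassCurve.eisensteinDVRSetting_h4_of`** — hence, for `σ`-stable `S` and inertia-compatible `φ_v` off `S`,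
  `SatisfiesH.h4` (`∀ k, (D k).IsSelfOrthogonal (t k).cond`) REDUCES to its clauses at the places `v ∈ S` — verbatim the `h4`
  input of D1's `eisensteinDVRSettingTame_satisfiesH_of`.
* `…_ofLifts` forms for the canonical datum `ConjugationDatum.ofLifts` (inertia compatibility automatic, `phi_mem_absInertia_iff`).

HONEST FRAMING: conditional on `poitouTate_selmerStructure_duality K` (Milne I Thm. 2.6 / 4.10 as a named fact); the places of
`S` (above `p`: ordinary condition; bad places) are NOT treated here.  BSD is not proved by any of this.

References: [Howard2004HeegnerKolyvagin] §1.3 H.4 (arXiv p. 7, L69–82), Def. 1.1.10, Def. 3.1.2; [MilneADT2006] I Thm. 2.6, Cor. 2.3.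
-/

set_option autoImplicit false

noncomputable section

open Function NumberField IsDedekindDomain Field
open scoped NumberField ContRepresentation TensorProduct Classical

namespace WeierstrassCurve

open Literature.NumberTheory.EllipticCurves Literature.NumberTheory.GaloisRepresentations
open Literature.NumberTheory.GaloisRepresentations.DiscreteGaloisModule
open Literature.NumberTheory.GaloisCohomology Literature.NumberTheory.GaloisCohomology.Howard2004
open Literature.NumberTheory.EllipticCurves.ZpExtension (EisensteinLevel)

variable {K : Type} [Field K] [NumberField K] (W : WeierstrassCurve ℚ) [W.IsElliptic] {p : ℕ} [hp : Fact p.Prime]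
  (κ : ZpExtension K p) {m : ℕ} (hm : 1 ≤ m)
  (S : Finset (HeightOneSpectrum (𝓞 K)))
  (hpS : ∀ v : HeightOneSpectrum (𝓞 K), ((p : ℕ) : 𝓞 K) ∈ v.asIdeal → v ∈ S)
  (hbad : ∀ v : HeightOneSpectrum (𝓞 K), v ∉ S → ((p : ℕ) : 𝓞 K) ∉ v.asIdeal → (W.baseChange K).HasGoodReductionAt v)
  (L : Set (HeightOneSpectrum (𝓞 K)))
  (hL : letI := IwasawaAlgebra.isLocalRing_quotient_X_pow_add_C p hm
    L ⊆ (W.eisensteinTower κ hm).degreeTwoPrimes p)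
  (hLS : ∀ v ∈ L, v ∉ S)
  (cd : ConjugationDatum K)
  (D : letI := IwasawaAlgebra.isLocalRing_quotient_X_pow_add_C p hm
    ∀ k, DualityDatum p cd ((W.eisensteinTower κ hm).ρ k) (IwasawaAlgebra.EisensteinCoeff p m (k + 1)))

/-- **The local condition `F_𝔮` of the tower triple at a finite place off `S ∪ {v ∣ p}` is `H¹_ur`.**
[cite: Howard2004HeegnerKolyvagin, Def. 1.1.10 and Def. 3.1.2] -/
theorem eisensteinTowerTriple_cond_inr_of_not_mem (k : ℕ) {v : HeightOneSpectrum (𝓞 K)}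
    (hv : ((p : ℕ) : 𝓞 K) ∉ v.asIdeal) (hvS : v ∉ S) :
    letI := IwasawaAlgebra.isLocalRing_quotient_X_pow_add_C p hm
    (W.eisensteinTowerTriple κ hm S hpS hbad L hL hLS k).cond (Sum.inr v) =
      unramifiedSubgroup (GaloisRep.toLocal v ((W.eisensteinTower κ hm).ρ k)) 1 := by
  letI := IwasawaAlgebra.isLocalRing_quotient_X_pow_add_C p hm
  unfold eisensteinTowerTriple
  rw [eisensteinSelmerTriple_cond]
  exact κ.eisensteinSelmerStructure_inr_of_not_mem _ _ hm S _ (k + 1) hv hvS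

/-- **H.4 at a good place for the curve's Eisenstein tower** (any H.4 data `D`): at a finite `v` with `v, σ•v ∉ S` and an
inertia-compatible local transport `φ_v`, `F_𝔮 = H¹_ur(K_v, T^{(k)})` is its own exact orthogonal complement under the induced
local pairing of `D k` — given the Poitou–Tate family of local invariants (`poitouTate_selmerStructure_duality K`).
[cite: Howard2004HeegnerKolyvagin, §1.3 H.4 (arXiv p. 7, L78–82) and Def. 1.1.10] [cite: MilneADT2006, Ch. I, Thm. 2.6] -/
theorem eisensteinTower_isSelfOrthogonalAt_of_not_mem (hPT : poitouTate_selmerStructure_duality K) (k : ℕ)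
    {v : HeightOneSpectrum (𝓞 K)} (hv : ((p : ℕ) : 𝓞 K) ∉ v.asIdeal) (hvS : v ∉ S)
    (hσv : ((p : ℕ) : 𝓞 K) ∉ (cd.σ • v).asIdeal) (hσvS : cd.σ • v ∉ S)
    (hI : ∀ g, g ∈ absInertia (v.adicCompletion K) ↔ cd.φ v g ∈ absInertia ((cd.σ • v).adicCompletion K)) :
    letI := IwasawaAlgebra.isLocalRing_quotient_X_pow_add_C p hm
    (D k).IsSelfOrthogonalAt (W.eisensteinTowerTriple κ hm S hpS hbad L hL hLS k).cond v := by
  letI := IwasawaAlgebra.isLocalRing_quotient_X_pow_add_C p hm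
  have hpp := hp.out
  haveI : NeZero (p ^ (k + 1)) := ⟨pow_ne_zero _ hpp.ne_zero⟩
  have hpK : (p : K) ≠ 0 := by exact_mod_cast hpp.ne_zero
  -- the level `T^{(k)} = E_K[p^{k+1}] ⊗ A_{m,k+1}` is finite and killed by `p^{k+1}`
  haveI : Finite (geomTorsion (W.baseChange K) ((p : ℤ) ^ (k + 1))) :=
    finite_torsionPoints_holds (W.baseChange K) (AlgebraicClosure K) (n := (p : ℤ) ^ (k + 1))
      (pow_ne_zero _ (by exact_mod_cast hpp.ne_zero))
  haveI : Finite (EisensteinLevel p m (fun j ↦ geomTorsion (W.baseChange K) ((p : ℤ) ^ j)) (k + 1)) :=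
    IwasawaAlgebra.EisensteinCoeff.finite_twisted (p := p) (k := k + 1)
      (M := geomTorsion (W.baseChange K) ((p : ℤ) ^ (k + 1))) hm
  have hM : ∀ x : EisensteinLevel p m (fun j ↦ geomTorsion (W.baseChange K) ((p : ℤ) ^ j)) (k + 1),
      (p ^ (k + 1)) • x = 0 := fun x ↦ by
    haveI := IwasawaAlgebra.EisensteinCoeff.charP p hm (k + 1)
    rw [← Nat.cast_smul_eq_nsmul (IwasawaAlgebra.EisensteinCoeff p m (k + 1)),
      CharP.cast_eq_zero (IwasawaAlgebra.EisensteinCoeff p m (k + 1)) (p ^ (k + 1)), zero_smul]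
  -- the Poitou–Tate family of local invariants at `n = p^{k+1}`
  obtain ⟨inv, hperf, -, hUO, -⟩ := hPT (p ^ (k + 1))
  -- `T^{(k)}` is unramified at `v`
  have hur : GaloisRep.IsUnramifiedAt v ((W.eisensteinTower κ hm).ρ k) :=
    (W.baseChange K).isUnramifiedAt_eisensteinTwist_torsionGaloisModule_of_not_mem κ hm hbad hvS hv (k + 1)
  -- the bridge data `λ = λ_{k+1}` (tail form) and `exp = log⁻¹`
  have hlam : ∀ (z : ℤ_[p]) (r : IwasawaAlgebra.EisensteinCoeff p m (k + 1)),
      (IwasawaAlgebra.EisensteinCoeff.tailFormZMod p hm (k + 1)).toAddMonoidHom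
          (algebraMap ℤ_[p] (IwasawaAlgebra.EisensteinCoeff p m (k + 1)) z * r) =
        PadicInt.toZModPow (k + 1) z *
          (IwasawaAlgebra.EisensteinCoeff.tailFormZMod p hm (k + 1)).toAddMonoidHom r := fun z r ↦ by
    rw [LinearMap.toAddMonoidHom_coe, IwasawaAlgebra.EisensteinCoeff.algebraMap_padicInt_eq_ofZMod_toZModPow p hm (k + 1),
      IwasawaAlgebra.EisensteinCoeff.tailFormZMod_ofZMod_mul]
  obtain ⟨log, hlogbij, hlogχ, -⟩ := exists_compatible_muLog K p hpK
  let Lg : MuCarrier K (p ^ (k + 1)) ≃+ ZMod (p ^ (k + 1)) := AddEquiv.ofBijective (log (k + 1)) (hlogbij (k + 1))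
  have hexpb : Function.Bijective (Lg.symm : ZMod (p ^ (k + 1)) →+ MuCarrier K (p ^ (k + 1))) := Lg.symm.bijective
  have hexp : ∀ (g : absoluteGaloisGroup K) (x : ZMod (p ^ (k + 1))),
      (Lg.symm : ZMod (p ^ (k + 1)) →+ MuCarrier K (p ^ (k + 1))) (cyclotomicCharacterModPow K p (k + 1) g * x) =
        mu K (p ^ (k + 1)) g ((Lg.symm : ZMod (p ^ (k + 1)) →+ MuCarrier K (p ^ (k + 1))) x) := fun g x ↦ by
    apply Lg.injective
    change Lg (Lg.symm _) = log (k + 1) (mu K _ g (Lg.symm x))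
    rw [AddEquiv.apply_symm_apply, hlogχ, show log (k + 1) (Lg.symm x) = Lg (Lg.symm x) from rfl,
      AddEquiv.apply_symm_apply]
  -- `Θ : Tw(T^{(k)}) → Hom(T^{(k)}, μ)` is bijective, and the dual family dualizes `A_{m,k+1}(1)`
  have hΘ := (D k).toTateDual_bijective _ hlam _ hexp hexpb
    (IwasawaAlgebra.EisensteinCoeff.tailFormZModComp_bijective p hm (k + 1))
  have hbij := IwasawaAlgebra.EisensteinCoeff.bijective_comp_tailFormZMod_dualFamily_mul p hm (k + 1) _ hexpb
  -- the conditions at `v` and `σ v` are the unramified ones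
  have h𝓕 := W.eisensteinTowerTriple_cond_inr_of_not_mem κ hm S hpS hbad L hL hLS k hv hvS
  have hFbar : ((W.eisensteinTowerTriple κ hm S hpS hbad L hL hLS k).cond (Sum.inr (cd.σ • v))).map
      (cd.transportH1 ((W.eisensteinTower κ hm).ρ k) v) =
        unramifiedSubgroup (GaloisRep.toLocal v (cd.twist ((W.eisensteinTower κ hm).ρ k))) 1 := by
    rw [W.eisensteinTowerTriple_cond_inr_of_not_mem κ hm S hpS hbad L hL hLS k hσv hσvS]
    exact cd.map_transportH1_unramifiedSubgroup_eq _ v hI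
  exact (D k).isSelfOrthogonalAt_of_unramified_of_bijective _ hlam _ hexp hM inv hperf hUO v hv hur hΘ
    (IwasawaAlgebra.EisensteinCoeff.dualFamily p hm (k + 1)) hbij _ h𝓕 hFbar

/-- **`SatisfiesH.h4` for the curve's Eisenstein setting reduces to the places of `S`**: for `σ`-stable `S` (containing the
places above `p` and the bad places) and a conjugation datum with inertia-compatible transports off `S`, H.4 at level `k` —
«`F_𝔮` is its own exact orthogonal complement at EVERY finite `v`» — follows from its clauses at `v ∈ S`; off `S` it is
`eisensteinTower_isSelfOrthogonalAt_of_not_mem` (given `poitouTate_selmerStructure_duality K`).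
[cite: Howard2004HeegnerKolyvagin, §1.3 H.4 (arXiv p. 7, L78–82) and Def. 3.1.2] [cite: MilneADT2006, Ch. I, Thm. 2.6] -/
theorem eisensteinDVRSetting_h4_of (hPT : poitouTate_selmerStructure_duality K)
    (hSσ : ∀ v : HeightOneSpectrum (𝓞 K), cd.σ • v ∈ S → v ∈ S)
    (hI : ∀ v : HeightOneSpectrum (𝓞 K), v ∉ S →
      ∀ g, g ∈ absInertia (v.adicCompletion K) ↔ cd.φ v g ∈ absInertia ((cd.σ • v).adicCompletion K))
    (hfin : letI := IwasawaAlgebra.isLocalRing_quotient_X_pow_add_C p hm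
      ∀ k, ∀ v ∈ S, (D k).IsSelfOrthogonalAt (W.eisensteinTowerTriple κ hm S hpS hbad L hL hLS k).cond v)
    (k : ℕ) :
    letI := IwasawaAlgebra.isLocalRing_quotient_X_pow_add_C p hm
    (D k).IsSelfOrthogonal (W.eisensteinTowerTriple κ hm S hpS hbad L hL hLS k).cond := by
  letI := IwasawaAlgebra.isLocalRing_quotient_X_pow_add_C p hm
  intro v
  by_cases hvS : v ∈ S
  · exact hfin k v hvS
  · have hσvS : cd.σ • v ∉ S := fun h ↦ hvS (hSσ v h)
    have hv : ((p : ℕ) : 𝓞 K) ∉ v.asIdeal := fun h ↦ hvS (hpS v h)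
    have hσv : ((p : ℕ) : 𝓞 K) ∉ (cd.σ • v).asIdeal := fun h ↦ hσvS (hpS _ h)
    exact W.eisensteinTower_isSelfOrthogonalAt_of_not_mem κ hm S hpS hbad L hL hLS cd D hPT k hv hvS hσv hσvS (hI v hvS)

/-- The `ofLifts` form: for the canonical conjugation datum `ConjugationDatum.ofLifts σ … τ …` the inertia compatibility of
the local transports is automatic (`phi_mem_absInertia_iff`), so `SatisfiesH.h4` reduces to its clauses at `v ∈ S` outright.
[cite: Howard2004HeegnerKolyvagin, §1.3 H.4 (arXiv p. 7, L78–82)] [cite: MilneADT2006, Ch. I, Thm. 2.6] -/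
theorem eisensteinDVRSetting_h4_of_ofLifts (hPT : poitouTate_selmerStructure_duality K)
    (σ : K ≃ₐ[ℚ] K) (hσ₁ : σ ≠ 1) (hσ : σ * σ = 1) (τ : AlgebraicClosure K ≃+* AlgebraicClosure K)
    (hτ : IsLiftOfAut σ τ) (hτ₂ : Function.Involutive τ)
    (D' : letI := IwasawaAlgebra.isLocalRing_quotient_X_pow_add_C p hm
      ∀ k, DualityDatum p (ConjugationDatum.ofLifts σ hσ₁ hσ τ hτ hτ₂) ((W.eisensteinTower κ hm).ρ k)
        (IwasawaAlgebra.EisensteinCoeff p m (k + 1)))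
    (hSσ : ∀ v : HeightOneSpectrum (𝓞 K), σ • v ∈ S → v ∈ S)
    (hfin : letI := IwasawaAlgebra.isLocalRing_quotient_X_pow_add_C p hm
      ∀ k, ∀ v ∈ S, (D' k).IsSelfOrthogonalAt (W.eisensteinTowerTriple κ hm S hpS hbad L hL hLS k).cond v)
    (k : ℕ) :
    letI := IwasawaAlgebra.isLocalRing_quotient_X_pow_add_C p hm
    (D' k).IsSelfOrthogonal (W.eisensteinTowerTriple κ hm S hpS hbad L hL hLS k).cond :=
  W.eisensteinDVRSetting_h4_of κ hm S hpS hbad L hL hLS (ConjugationDatum.ofLifts σ hσ₁ hσ τ hτ hτ₂) D' hPT hSσ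
    (fun v _ ↦ ConjugationDatum.phi_mem_absInertia_iff hσ v) hfin k

end WeierstrassCurve

end
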